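import Summits.BirchSwinnertonDyer.BirchSwinnertonDyer.Theorems.ByReductionTypeAtTwoTowerClassKit
import Summits.BirchSwinnertonDyer.BirchSwinnertonDyer.Theorems.ByReductionTypeAtTwoTowerLayerCert
import HarnessLib

/-!
# TOWER-road class instances — KIT, part B: the `W`-generic DOORS from a tower-gap certificate on the
# `E[2]`-irreducible good-ordinary-at-`2` block, with the Néron-period binder discharged by PRINT
# (Abbes–Ullmo), and the closed arithmetic of the gap certificate with VARIABLE layer counts
# (route ByReductionTypeAtTwo, items 19573 `OrdKatoHalfAtTwoIso` / 19271 `OrdKatoHalfAtTwo`;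
# seat bsd-2adic-ord-2, GEN 3)

HONEST FRAMING (cell `bsd-2adic`, run/shared/lean/pub/bsd-2adic/, HUMAN RULINGS D-0036 / D-0054 / D-0074):
THEOREMS ONLY; nothing asserted; no new named fact; closes nothing by itself. For a globally minimal
elliptic `W/ℚ`, good ordinary at `2`, with `E[2]` irreducible (`Irr W 2`), and a tower-gap certificate
`hgap : X5.O1.TowerGapAtTwo W` (produced per class by tower-1's decidable door
`KatoHalfPinch.towerGapAtTwo_of_layerSelmer_cert` from two layer-Selmer counts), the per-class files
(`…TowerClass<label>.lean`) close, BY NAME and in one line each: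

* `mainConjectureLowerDivisibilityAtTwoOrd_of_towerGap_of_abbesUllmo` — the Kato–Néron half AT `W`
  (item `OrdKatoHalfAtTwo` 19271 at `W`) from PRINT {`h17` Kato 17.4 (1)(2)@2, `hAU` Abbes–Ullmo Thm. A}
  + `hgap`: `μ = 0` from the gap upgrades Kato's `Λ[1/2]`-divisibility to `Λ`
  (X5 `O1.mainConjectureLowerDivisibilityAtTwoOrd_of_towerGapAtTwo`), and the Néron integrality input is
  `periodRatio_nonneg_of_irr_two_of_abbesUllmo` (Kit part A) — NO period certificate, NO `λ_an`/`μ_an`,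
  NO rank certificate, NO Prop. 4.14;
* `exists_isIsogenous_mainConjectureLowerDivisibilityAtTwoOrd_of_towerGap_of_abbesUllmo` — its
  ∃-isogenous form (item `OrdKatoHalfAtTwoIso` 19573 at `W`; witness `W` itself);
* `missingUpperBoundAt_two_/bsdp_two_/mazurMainConjecture_two_of_towerGap_of_abbesUllmo` — the typed
  upper half, `BSD(W,2)` and the `2`-adic IMC at analytic rank `0` (+ PRINT {`hEC`, `hmod`, `hGZK`},
  certificate `hr`, and for the last two the descent inequality `MissingLowerBoundAt W 2` — ord-3's
  `Ш`-currency pinch `EisensteinShaCurrency.*_of_towerGap_of_missingLowerBoundAt`);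
* `two_pow_mul_four_mul_two_pow_lt` — the closed arithmetic of the gap certificate with VARIABLE counts:
  `d + m + 3 ≤ K + a ⇒ 2^d · 4 · 2^m < 2^{K + a}` (so one class theorem serves every outcome of the
  engines' layer table: `a ≤ d_j`, `d_{j'} ≤ d`).

References: [Kato2004Asterisque] Thm. 17.4; [AbbesUllmo1996] Thm. A; [GreenbergLNM1716] Thm. 4.1, §3;
[Miller2011LMS] Def. 1.1; [Washington1997] §13.2.
-/

set_option autoImplicit false

noncomputable section

open scoped Classical MatrixGroups ModularForm

open NumberField IsDedekindDomain CongruenceSubgroup WeierstrassCurve Literature.NumberTheory.EllipticCurves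
  Literature.NumberTheory.EllipticCurves.ModularForms Literature.NumberTheory.EllipticCurves.Rank1Residual
  Literature.NumberTheory.EllipticCurves.Rank1Residual.Typed
  Literature.NumberTheory.EllipticCurves.Greenberg1999
  Summit.BirchSwinnertonDyer.Rank1Residual.X5 Summit.BirchSwinnertonDyer.Rank1Residual.X5.O1
  Summit.BirchSwinnertonDyer.BirchSwinnertonDyer.Theorems.KatoHalfPinch
  Summit.BirchSwinnertonDyer.BirchSwinnertonDyer.Theorems.Rank1ResidualX1Defs

namespace Summit.BirchSwinnertonDyer.BirchSwinnertonDyer.Theorems.TowerClass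

/-! ## §1 The closed arithmetic with variable counts -/

/-- **`d + m + 3 ≤ K + a ⇒ 2^d · 4 · 2^m < 2^{K + a}`** — the arithmetic certificate of the tower gap
once the local product has been evaluated to `2^m` and `2^{j'} − 2^j` to `K`. [folklore] -/
theorem two_pow_mul_four_mul_two_pow_lt {d m K a : ℕ} (h : d + m + 3 ≤ K + a) :
    2 ^ d * 4 * 2 ^ m < 2 ^ (K + a) := by
  rw [show (2 : ℕ) ^ d * 4 * 2 ^ m = 2 ^ (d + 2 + m) by rw [pow_add, pow_add]; norm_num]
  exact Nat.pow_lt_pow_right (by norm_num) (by omega)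

/-! ## §2 The `W`-generic doors from a tower-gap certificate (irreducible `E[2]`, good ordinary `2`) -/

section Doors

variable (W : WeierstrassCurve ℚ) [W.IsElliptic] [W.IsGloballyMinimal]

/-- **The Kato–Néron half AT `W` (item `OrdKatoHalfAtTwo` at `W`) from a tower-gap certificate**, PRINT
{`h17`, `hAU`} + kernel {`GoodOrd W 2`, `Irr W 2`} + `hgap`. [cite: Kato2004Asterisque, Thm. 17.4 (1)(2) (p. 273)]
[cite: AbbesUllmo1996, Thm. A] [cite: MazurTateTeitelbaum1986Invent, §I.12] -/
theorem mainConjectureLowerDivisibilityAtTwoOrd_of_towerGap_of_abbesUllmo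
    (h17 : ∀ [NeZero (W.conductorNorm ℤ)] (f : CuspForm (Gamma0 (W.conductorNorm ℤ)) 2),
      kato_divisibility_allPrimes W 2 (f := f))
    (hAU : abbesUllmo_not_dvd_maninConstant_of_not_dvd_level) (hgo : GoodOrd W 2) (hirr : Irr W 2)
    (hgap : TowerGapAtTwo W) : MainConjectureLowerDivisibilityAtTwoOrd W := by
  have hord : IsOrdinaryAt W 2 := hgo
  refine mainConjectureLowerDivisibilityAtTwoOrd_of_towerGapAtTwo W h17 ?_ hgap
  intro _ f hf ϖ hϖ
  exact exists_integral_mul_padicLFunction_two_of_padicValRat_nonneg W hord hf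
    (periodRatio_nonneg_of_irr_two_of_abbesUllmo W hAU hgo hirr f hf ϖ hϖ)

/-- **The ∃-isogenous form AT `W` (item `OrdKatoHalfAtTwoIso` at `W`)**, witness `W` itself
(`IsIsogenous.refl_holds`). [cite: Kato2004Asterisque, Thm. 17.4 (1)(2) (p. 273)] [cite: SilvermanAEC2009, III.4] -/
theorem exists_isIsogenous_mainConjectureLowerDivisibilityAtTwoOrd_of_towerGap_of_abbesUllmo
    (h17 : ∀ [NeZero (W.conductorNorm ℤ)] (f : CuspForm (Gamma0 (W.conductorNorm ℤ)) 2),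
      kato_divisibility_allPrimes W 2 (f := f))
    (hAU : abbesUllmo_not_dvd_maninConstant_of_not_dvd_level) (hgo : GoodOrd W 2) (hirr : Irr W 2)
    (hgap : TowerGapAtTwo W) :
    ∃ (W' : WeierstrassCurve ℚ) (_ : W'.IsElliptic) (_ : W'.IsGloballyMinimal),
      IsIsogenous W W' ∧ MainConjectureLowerDivisibilityAtTwoOrd W' :=
  ⟨W, inferInstance, inferInstance, IsIsogenous.refl_holds W,
    mainConjectureLowerDivisibilityAtTwoOrd_of_towerGap_of_abbesUllmo W h17 hAU hgo hirr hgap⟩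

/-- **The typed UPPER half `MissingUpperBoundAt W 2` from a tower-gap certificate** at analytic rank `0`,
PRINT {`h17`, `hAU`, `hEC`, `hmod`, `hGZK`} + `hr`. [cite: GreenbergLNM1716, Thm. 4.1 (p. 102)]
[cite: Kato2004Asterisque, Thm. 17.4 (1)(2) (p. 273)] -/
theorem missingUpperBoundAt_two_of_towerGap_of_abbesUllmo (hEC : TwoAdicEulerCharRankZero W 0)
    (hmod : nonempty_modularParametrizationData) (hGZK : rank_eq_analyticRank_of_analyticRank_le_one)
    (h17 : ∀ [NeZero (W.conductorNorm ℤ)] (f : CuspForm (Gamma0 (W.conductorNorm ℤ)) 2),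
      kato_divisibility_allPrimes W 2 (f := f))
    (hAU : abbesUllmo_not_dvd_maninConstant_of_not_dvd_level) (hgo : GoodOrd W 2) (hirr : Irr W 2)
    (hr : W.analyticRank = 0) (hgap : TowerGapAtTwo W) : MissingUpperBoundAt W 2 := by
  have hord : IsOrdinaryAt W 2 := hgo
  refine missingUpperBoundAt_two_of_towerGap W hEC hmod hGZK h17 hgap ?_ hr hgo
  intro _ f hf ϖ hϖ
  exact exists_integral_mul_padicLFunction_two_of_padicValRat_nonneg W hord hf
    (periodRatio_nonneg_of_irr_two_of_abbesUllmo W hAU hgo hirr f hf ϖ hϖ)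

/-- **`BSD(W,2)` from a tower-gap certificate + the descent inequality** (ord-3's `Ш`-currency pinch),
PRINT {`h17`, `hAU`, `hEC`, `hmod`, `hGZK`} + CERT {`hr`, `hgap`, `hsha`}. [cite: Miller2011LMS, Def. 1.1]
[cite: GreenbergLNM1716, Thm. 4.1 (p. 102)] [cite: Kato2004Asterisque, Thm. 17.4 (1)(2) (p. 273)] -/
theorem bsdp_two_of_towerGap_of_abbesUllmo (hEC : TwoAdicEulerCharRankZero W 0)
    (hmod : nonempty_modularParametrizationData) (hGZK : rank_eq_analyticRank_of_analyticRank_le_one)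
    (h17 : ∀ [NeZero (W.conductorNorm ℤ)] (f : CuspForm (Gamma0 (W.conductorNorm ℤ)) 2),
      kato_divisibility_allPrimes W 2 (f := f))
    (hAU : abbesUllmo_not_dvd_maninConstant_of_not_dvd_level) (hgo : GoodOrd W 2) (hirr : Irr W 2)
    (hr : W.analyticRank = 0) (hgap : TowerGapAtTwo W) (hsha : MissingLowerBoundAt W 2) : BSDp W 2 :=
  EisensteinShaCurrency.bsdp_two_of_towerGap_of_missingLowerBoundAt W h17
    (periodRatio_nonneg_of_irr_two_of_abbesUllmo W hAU hgo hirr) hEC hGZK hmod hgo hr hgap hsha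

/-- **The `2`-adic cyclotomic main conjecture `MazurMainConjecture W 2` from a tower-gap certificate +
the descent inequality**, same binders. [cite: Kato2004Asterisque, Thm. 17.4 (1)(2) (p. 273)]
[cite: GreenbergLNM1716, Thm. 4.1 (p. 102), §3 Lemmas 3.3–3.5] [cite: Washington1997, §13.2] -/
theorem mazurMainConjecture_two_of_towerGap_of_abbesUllmo (hEC : TwoAdicEulerCharRankZero W 0)
    (hmod : nonempty_modularParametrizationData) (hGZK : rank_eq_analyticRank_of_analyticRank_le_one)
    (h17 : ∀ [NeZero (W.conductorNorm ℤ)] (f : CuspForm (Gamma0 (W.conductorNorm ℤ)) 2),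
      kato_divisibility_allPrimes W 2 (f := f))
    (hAU : abbesUllmo_not_dvd_maninConstant_of_not_dvd_level) (hgo : GoodOrd W 2) (hirr : Irr W 2)
    (hr : W.analyticRank = 0) (hgap : TowerGapAtTwo W) (hsha : MissingLowerBoundAt W 2) :
    MazurMainConjecture W 2 :=
  EisensteinShaCurrency.mazurMainConjecture_two_of_towerGap_of_missingLowerBoundAt W h17
    (periodRatio_nonneg_of_irr_two_of_abbesUllmo W hAU hgo hirr) hEC hGZK hmod hgo hr hgap hsha

end Doors

end Summit.BirchSwinnertonDyer.BirchSwinnertonDyer.Theorems.TowerClass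

end
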